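import Literature.AlgebraicGeometry.ShimuraVarieties.UnitaryBallSpecialCycleFinite
import Literature.Geometry.ComplexHyperbolic.UnitBallMeasure
import Mathlib.LinearAlgebra.CrossProduct
import HarnessLib

/-!
# Special sub-balls of an arithmetic ball quotient: coordinates, the special locus, closedness

Topic `AlgebraicGeometry/ShimuraVarieties`; namespace
`Literature.AlgebraicGeometry.ShimuraVarieties` (datum API dotted on `UnitaryBallUniformisationDatum`).
Continuation of `UnitaryBallSpecialCycleFinite` (Kudla–Millson Lemma 1.1, arithmetic core). For a
unitary ball-quotient datum `D : UnitaryBallUniformisationDatum 2 X`, a Sylvester frame `𝔣` and an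
`E`-subspace `W ⊆ V = E³`:

* COORDINATES. `D.dualVec s = (H^{τ₁})ᵀ · conj(τ₁ s)` represents the pairing, `⟪τ₁ s, v⟫ = dualVec s ⬝ v`
  (`pairE_eq_dualVec_dotProduct`), and `D.ballVec 𝔣 s = Tᵀ dualVec s` represents it on the affine
  ball: `⟪τ₁ s, T(z,1)⟫ = b₀ z₀ + b₁ z₁ + b₂` (`pairE_coneLift_eq_ballVec`). Hence a special sub-ball
  `𝔹(s^⊥)` (`s ≠ 0`) is the trace on `𝔹²` of a proper affine subspace of `ℂ²`: it has EMPTY INTERIOR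
  (`interior_specialBall_singleton`); the special sub-ball of two independent vectors is a point or
  empty (`subsingleton_specialBall_pair`: two negative lines orthogonal to a `2`-plane coincide, the
  orthogonal complement being the line of the cross product); and `𝔹(V^⊥) = ∅`
  (`specialBall_univ`).
* THE SPECIAL LOCUS `D.specialLocus 𝔣 W = ⋃_γ 𝔹((γW)^⊥)` — the `Γ`-saturation of `𝔹(W^⊥)`, i.e. the
  full preimage of the special cycle of `W` in the ball — is `Γ`-invariant, LOCALLY a finite union of
  translates (`exists_isOpen_specialLocus_inter_eq`, from `finite_specialBall_translates_submodule`),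
  hence CLOSED (`isClosed_specialLocus`: "`j₁` is a proper embedding", Kudla–Millson Lemma 1.1); it
  has empty interior for `W ≠ 0` (`interior_specialLocus_eq_empty`) and is discrete for
  `dim_E W = 2` (`finite_specialLocus_inter_of_finrank_eq_two`), empty for `W = V`.
* IN `X(ℂ)`: the uniformisation `ballUnifMap : 𝔹² → X(ℂ)` is open (`isOpenMap_ballUnifMap`); the
  special cycle `ballUnifMap '' 𝔹(W^⊥)` is the image of the special locus, its preimage is the special
  locus, and it is CLOSED in `X(ℂ)` (`isClosed_image_specialBall`); it is the set
  `unif '' subCone(τ₁ W)` of the datum's special-cycle clause (`image_unif_subCone_eq`).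

References: S. Kudla, J. Millson, Publ. Math. IHÉS 71 (1990), Lemma 1.1 p. 128 ("`j₁` is a proper
embedding onto a totally geodesic submanifold"); N. Bergeron, J. Millson, C. Moeglin, Acta Math. 216
(2016), Introduction §1.7 and Part 2 §§3.2–3.3 (special cycles `Γ_W\D_W → Γ\D` of complex
codimension `dim W`).

## Provenance

Written for the pub-hodgecm2 (COR-CM) cell, lane SPECIAL-CYCLES (seat b06): second of the files
proving the record `Literature.NumberTheory.Automorphic.PicardCM.SpecialCyclesAlgebraic`. Nothing
in this file is a claim of the manuscripts adjudicated by that cell.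
-/

set_option autoImplicit false

noncomputable section

open Matrix Complex ComplexConjugate NumberField
open Literature.Geometry.ComplexHyperbolic
open Literature.Geometry.ComplexHyperbolic.BallModel
open scoped Topology

namespace Literature.AlgebraicGeometry.ShimuraVarieties

namespace UnitaryBallUniformisationDatum

open Literature.AlgebraicGeometry.Motives (SchemeOver ComplexPoints)

variable {X₂ : SchemeOver ℂ} (D : UnitaryBallUniformisationDatum 2 X₂) (𝔣 : D.SylvesterFrame)

/-! ### The pairing as a dot product: `dualVec` and `ballVec` -/

/-- The vector representing the pairing with `s ∈ V`: `dualVec s = (H^{τ₁})ᵀ conj(τ₁ s)`, so that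
`⟪τ₁ s, v⟫ = dualVec s ⬝ v`. [cite: BergeronMillsonMoeglin2016Balls, Part 2 §1.1] -/
def dualVec (s : Fin 3 → D.E) : Fin 3 → ℂ :=
  D.Hℂᵀ *ᵥ star (D.τ₁ ∘ s)

/-- `⟪τ₁ s, v⟫ = dualVec s ⬝ v`. [cite: BergeronMillsonMoeglin2016Balls, Part 2 §1.1] -/
theorem pairE_eq_dualVec_dotProduct (s : Fin 3 → D.E) (v : Fin 3 → ℂ) :
    D.pairE s v = D.dualVec s ⬝ᵥ v := by
  rw [pairE_eq, dualVec, dotProduct_mulVec, mulVec_transpose]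

/-- `H^{τ₁}` is invertible (`H^{τ₁} = T⁻ᴴ J T⁻¹` in a Sylvester frame, `det J = -1`).
[cite: BergeronMillsonMoeglin2016Balls, Part 2 §1.1] -/
theorem isUnit_Hℂ : IsUnit D.Hℂ := by
  obtain ⟨𝔣⟩ := D.nonempty_sylvesterFrame
  rw [isUnit_iff_isUnit_det, 𝔣.Hℂ_eq, det_mul, det_mul, det_conjTranspose, BallModel.det_J]
  have hti : IsUnit 𝔣.ti.det := by
    rw [← isUnit_iff_isUnit_det]
    exact Units.isUnit _
  exact ((hti.star).mul (by norm_num)).mul hti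

/-- `s ↦ dualVec s` vanishes only at `s = 0`. [cite: BergeronMillsonMoeglin2016Balls, Part 2 §1.1] -/
theorem dualVec_eq_zero_iff {s : Fin 3 → D.E} : D.dualVec s = 0 ↔ s = 0 := by
  constructor
  · intro h
    have hinj : Function.Injective D.Hℂᵀ.mulVec :=
      mulVec_injective_iff_isUnit.2 ((isUnit_transpose _).2 D.isUnit_Hℂ)
    have h0 : star (D.τ₁ ∘ s) = 0 := hinj (by rw [mulVec_zero]; exact h)
    have h1 : D.τ₁ ∘ s = 0 := by simpa using congrArg star h0
    funext i
    exact D.τ₁.injective (by simpa using congrFun h1 i)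
  · rintro rfl
    simp [dualVec]

/-- The vector representing the pairing on the affine ball: `ballVec s = Tᵀ dualVec s`, so that
`⟪τ₁ s, T(z,1)⟫ = ballVec s ⬝ (z₀, z₁, 1)`. [cite: BergeronMillsonMoeglin2016Balls, Part 2 §1.3] -/
def ballVec (s : Fin 3 → D.E) : Fin 3 → ℂ :=
  𝔣.tᵀ *ᵥ D.dualVec s

/-- **The pairing on the affine ball is affine**: `⟪τ₁ s, T(z,1)⟫ = b₀ z₀ + b₁ z₁ + b₂` with
`b = ballVec s`. [cite: BergeronMillsonMoeglin2016Balls, Part 2 §1.3] -/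
theorem pairE_coneLift_eq_ballVec (s : Fin 3 → D.E) (z : Ball) :
    D.pairE s (D.coneLift 𝔣 z : Fin 3 → ℂ) =
      D.ballVec 𝔣 s 0 * z.1 0 + D.ballVec 𝔣 s 1 * z.1 1 + D.ballVec 𝔣 s 2 := by
  have hlift : ((D.coneLift 𝔣 z : D.cone) : Fin 3 → ℂ) = 𝔣.t *ᵥ BallModel.lift z := rfl
  rw [pairE_eq_dualVec_dotProduct, hlift, dotProduct_mulVec, ← mulVec_transpose, ballVec,
    dotProduct, Fin.sum_univ_three]
  simp [BallModel.lift]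

/-- `ballVec s = 0 ↔ s = 0`. [cite: BergeronMillsonMoeglin2016Balls, Part 2 §1.3] -/
theorem ballVec_eq_zero_iff {s : Fin 3 → D.E} : D.ballVec 𝔣 s = 0 ↔ s = 0 := by
  rw [← D.dualVec_eq_zero_iff]
  constructor
  · intro h
    have hinj : Function.Injective 𝔣.tᵀ.mulVec :=
      mulVec_injective_iff_isUnit.2 ((isUnit_transpose _).2 (Units.isUnit _))
    exact hinj (by rw [mulVec_zero]; exact h)
  · intro h
    rw [ballVec, h, mulVec_zero]

/-- Membership in the special sub-ball of one vector, in ball coordinates: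
`b₀ z₀ + b₁ z₁ + b₂ = 0`. [cite: BergeronMillsonMoeglin2016Balls, Part 2 §3.3] -/
theorem mem_specialBall_singleton_iff {s : Fin 3 → D.E} {z : Ball} :
    z ∈ D.specialBall 𝔣 {s} ↔
      D.ballVec 𝔣 s 0 * z.1 0 + D.ballVec 𝔣 s 1 * z.1 1 + D.ballVec 𝔣 s 2 = 0 := by
  rw [specialBall_singleton, Set.mem_setOf_eq, pairE_coneLift_eq_ballVec]

/-! ### A special sub-ball of one non-zero vector has empty interior -/

/-- **`𝔹(s^⊥)` is nowhere dense for `s ≠ 0`**: the special sub-ball of a non-zero vector is the trace on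
the (open) ball of a proper affine subspace `{b₀ z₀ + b₁ z₁ + b₂ = 0}` of `ℂ²`, so it has empty
interior (move off it in the direction `(b̄₀, b̄₁)`). [cite: BergeronMillsonMoeglin2016Balls, Part 2 §3.3] -/
theorem interior_specialBall_singleton {s : Fin 3 → D.E} (hs : s ≠ 0) :
    interior (D.specialBall 𝔣 {s}) = ∅ := by
  obtain ⟨b, hb⟩ : ∃ b : Fin 3 → ℂ, D.ballVec 𝔣 s = b := ⟨_, rfl⟩
  have hb0 : b ≠ 0 := fun h ↦ hs ((D.ballVec_eq_zero_iff 𝔣).1 (hb.trans h))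
  have hmem : ∀ w : Ball, w ∈ D.specialBall 𝔣 {s} ↔ b 0 * w.1 0 + b 1 * w.1 1 + b 2 = 0 := fun w ↦ by
    rw [mem_specialBall_singleton_iff, hb]
  rw [Set.eq_empty_iff_forall_notMem]
  intro z hz
  -- the interior is open in the ball, hence its image is open in `ℂ²`
  have hopen : IsOpen ((fun w : Ball ↦ (w.1 : Fin 2 → ℂ)) '' interior (D.specialBall 𝔣 {s})) :=
    isOpenEmbedding_coe.isOpenMap _ isOpen_interior
  obtain ⟨r, hr, hball⟩ := Metric.isOpen_iff.1 hopen z.1 ⟨z, hz, rfl⟩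
  -- the direction `d = (b̄₀, b̄₁)` and a small real step
  set d : Fin 2 → ℂ := ![starRingEnd ℂ (b 0), starRingEnd ℂ (b 1)] with hd
  set ε : ℝ := r / (2 * (‖d‖ + 1)) with hε
  have hεpos : 0 < ε := by positivity
  have hmemball : z.1 + (ε : ℂ) • d ∈ Metric.ball z.1 r := by
    rw [Metric.mem_ball, dist_eq_norm, add_sub_cancel_left, norm_smul, Complex.norm_real,
      Real.norm_eq_abs, abs_of_pos hεpos]
    calc ε * ‖d‖ ≤ ε * (‖d‖ + 1) := by gcongr; linarith
      _ = r / 2 := by rw [hε]; field_simp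
      _ < r := by linarith
  obtain ⟨z', hz', hz'eq⟩ := hball hmemball
  -- both `z` and `z'` lie on the affine subspace
  have h1 := (hmem z).1 (interior_subset hz)
  have h2 := (hmem z').1 (interior_subset hz')
  have hz'eq' : z'.1 = z.1 + (ε : ℂ) • d := hz'eq
  rw [hz'eq'] at h2
  simp only [Pi.add_apply, Pi.smul_apply, smul_eq_mul, hd, Matrix.cons_val_zero,
    Matrix.cons_val_one] at h2
  -- subtracting: `ε (|b₀|² + |b₁|²) = 0`
  have h3 : (ε : ℂ) * (b 0 * starRingEnd ℂ (b 0) + b 1 * starRingEnd ℂ (b 1)) = 0 := by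
    linear_combination h2 - h1
  rw [mul_eq_zero] at h3
  rcases h3 with h3 | h3
  · exact hεpos.ne' (by exact_mod_cast h3)
  · rw [Complex.mul_conj, Complex.mul_conj, ← Complex.ofReal_add] at h3
    have h4 : Complex.normSq (b 0) + Complex.normSq (b 1) = 0 := by exact_mod_cast h3
    have h5 : Complex.normSq (b 0) = 0 ∧ Complex.normSq (b 1) = 0 := by
      constructor <;> nlinarith [Complex.normSq_nonneg (b 0), Complex.normSq_nonneg (b 1)]
    rw [Complex.normSq_eq_zero, Complex.normSq_eq_zero] at h5
    -- then `b₂ ≠ 0` and the sub-ball is empty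
    have hb2 : b 2 ≠ 0 := by
      intro h
      apply hb0
      funext i
      fin_cases i
      · exact h5.1
      · exact h5.2
      · exact h
    apply hb2
    simpa [h5.1, h5.2] using h1

/-! ### The special sub-ball of two independent vectors is a point (or empty) -/

/-- A ring homomorphism commutes with the cross product. [folklore] -/
private theorem map_crossProduct {R S : Type*} [CommRing R] [CommRing S] (f : R →+* S)
    (v w : Fin 3 → R) : f ∘ (v ⨯₃ w) = (f ∘ v) ⨯₃ (f ∘ w) := by
  funext i
  fin_cases i <;> simp [cross_apply]

/-- `E`-linearly independent vectors of `V` stay `ℂ`-linearly independent in `V_{τ₁} = ℂ³` (their cross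
product is a non-zero vector of `E³`). [cite: BergeronMillsonMoeglin2016Balls, Part 2 §1.1] -/
theorem linearIndependent_embedding {s s' : Fin 3 → D.E} (h : LinearIndependent D.E ![s, s']) :
    LinearIndependent ℂ ![D.τ₁ ∘ s, D.τ₁ ∘ s'] := by
  rw [← crossProduct_ne_zero_iff_linearIndependent] at h ⊢
  intro h0
  apply h
  have hmap : D.τ₁ ∘ (s ⨯₃ s') = (D.τ₁ ∘ s) ⨯₃ (D.τ₁ ∘ s') := map_crossProduct D.τ₁ s s'
  funext i
  have := congrFun hmap i
  rw [h0] at this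
  exact D.τ₁.injective (by simpa using this)

/-- The representing vectors of independent `s, s'` are independent.
[cite: BergeronMillsonMoeglin2016Balls, Part 2 §1.1] -/
theorem linearIndependent_dualVec {s s' : Fin 3 → D.E} (h : LinearIndependent D.E ![s, s']) :
    LinearIndependent ℂ ![D.dualVec s, D.dualVec s'] := by
  have h1 := D.linearIndependent_embedding h
  rw [LinearIndependent.pair_iff] at h1 ⊢
  intro a b hab
  have hinj : Function.Injective D.Hℂᵀ.mulVec :=
    mulVec_injective_iff_isUnit.2 ((isUnit_transpose _).2 D.isUnit_Hℂ)
  have h2 : a • star (D.τ₁ ∘ s) + b • star (D.τ₁ ∘ s') = 0 := by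
    apply hinj
    rw [mulVec_add, mulVec_smul, mulVec_smul, mulVec_zero]
    exact hab
  have h3 : starRingEnd ℂ a • (D.τ₁ ∘ s) + starRingEnd ℂ b • (D.τ₁ ∘ s') = 0 := by
    have := congrArg star h2
    rw [star_add, star_smul, star_smul, star_star, star_star, star_zero] at this
    simpa using this
  obtain ⟨ha, hb⟩ := h1 _ _ h3
  exact ⟨by simpa using congrArg (starRingEnd ℂ) ha, by simpa using congrArg (starRingEnd ℂ) hb⟩

/-- **Two negative vectors orthogonal to a `2`-plane are proportional**: if `v, v' ∈ V_{τ₁}` are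
non-zero and orthogonal to `τ₁ s, τ₁ s'` for independent `s, s' ∈ V`, then `v' = c v` (the common
orthogonal complement is the line of `dualVec s × dualVec s'`).
[cite: BergeronMillsonMoeglin2016Balls, Part 2 §3.3] -/
theorem exists_eq_smul_of_pairE_eq_zero {s s' : Fin 3 → D.E} (h : LinearIndependent D.E ![s, s'])
    {v v' : Fin 3 → ℂ} (hv : v ≠ 0) (hs : D.pairE s v = 0) (hs' : D.pairE s' v = 0)
    (ht : D.pairE s v' = 0) (ht' : D.pairE s' v' = 0) : ∃ c : ℂ, v' = c • v := by
  set a := D.dualVec s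
  set a' := D.dualVec s'
  have hc : a ⨯₃ a' ≠ 0 := crossProduct_ne_zero_iff_linearIndependent.2 (D.linearIndependent_dualVec h)
  rw [pairE_eq_dualVec_dotProduct] at hs hs' ht ht'
  -- any vector orthogonal to `a, a'` is a multiple of `a × a'`
  have key : ∀ u : Fin 3 → ℂ, a ⬝ᵥ u = 0 → a' ⬝ᵥ u = 0 → ∃ μ : ℂ, μ • (a ⨯₃ a') = u := by
    intro u hu hu'
    have h0 : (a ⨯₃ a') ⨯₃ u = 0 := by
      rw [cross_cross_eq_smul_sub_smul, hu, hu', zero_smul, zero_smul, sub_zero]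
    have h1 : ¬ LinearIndependent ℂ ![a ⨯₃ a', u] :=
      fun hli ↦ (crossProduct_ne_zero_iff_linearIndependent.2 hli) h0
    rw [LinearIndependent.pair_iff' hc] at h1
    obtain ⟨μ, hμ⟩ := not_forall.1 h1
    exact ⟨μ, not_ne_iff.1 hμ⟩
  obtain ⟨μ, hμ⟩ := key v hs hs'
  obtain ⟨μ', hμ'⟩ := key v' ht ht'
  have hμ0 : μ ≠ 0 := by
    rintro rfl
    exact hv (by rw [← hμ, zero_smul])
  refine ⟨μ' / μ, ?_⟩
  rw [← hμ, ← hμ', smul_smul, div_mul_cancel₀ _ hμ0]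

/-- **The special sub-ball of two independent vectors is a point or empty**: two ball points whose
lifts are orthogonal to `τ₁ s` and `τ₁ s'` have proportional lifts, hence coincide (`dim_E W = 2`:
the special cycle of `W` consists of special POINTS). [cite: BergeronMillsonMoeglin2016Balls, Introduction §1.7] -/
theorem subsingleton_specialBall_pair {s s' : Fin 3 → D.E} (h : LinearIndependent D.E ![s, s']) :
    (D.specialBall 𝔣 {s, s'}).Subsingleton := by
  intro z hz z' hz'
  have hzs : ∀ t ∈ ({s, s'} : Set (Fin 3 → D.E)), D.pairE t (D.coneLift 𝔣 z : Fin 3 → ℂ) = 0 := hz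
  have hzs' : ∀ t ∈ ({s, s'} : Set (Fin 3 → D.E)), D.pairE t (D.coneLift 𝔣 z' : Fin 3 → ℂ) = 0 := hz'
  have hv : ((D.coneLift 𝔣 z : D.cone) : Fin 3 → ℂ) ≠ 0 := by
    intro h0
    have hneg := mem_negCone_iff.1 (D.coneLift 𝔣 z).2
    rw [h0] at hneg
    simp at hneg
  obtain ⟨c, hc⟩ := D.exists_eq_smul_of_pairE_eq_zero h hv (hzs s (by simp)) (hzs s' (by simp))
    (hzs' s (by simp)) (hzs' s' (by simp))
  have hc0 : c ≠ 0 := by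
    rintro rfl
    have hneg := mem_negCone_iff.1 (D.coneLift 𝔣 z').2
    rw [hc, zero_smul] at hneg
    simp at hneg
  have hchart : D.coneChart 𝔣 (D.coneLift 𝔣 z') = D.coneChart 𝔣 (D.coneLift 𝔣 z) :=
    (D.coneChart_eq_iff 𝔣 _ _).2 ⟨c, hc0, hc⟩
  rw [coneChart_coneLift, coneChart_coneLift] at hchart
  exact hchart.symm

/-- **`𝔹(V^⊥) = ∅`**: no negative vector is orthogonal to all of `V` (it would be orthogonal to itself).
[cite: BergeronMillsonMoeglin2016Balls, Part 2 §3.3] -/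
theorem specialBall_univ : D.specialBall 𝔣 Set.univ = ∅ := by
  rw [Set.eq_empty_iff_forall_notMem]
  intro z hz
  set v : Fin 3 → ℂ := (D.coneLift 𝔣 z : Fin 3 → ℂ)
  have hHv : D.Hℂ *ᵥ v = 0 := by
    funext i
    have h := hz (Pi.single i 1) (Set.mem_univ _)
    rw [pairE_eq] at h
    have heq : star (D.τ₁ ∘ Pi.single i (1 : D.E)) = Pi.single i (1 : ℂ) := by
      funext j
      by_cases hij : j = i
      · subst hij; simp
      · simp [hij]
    rw [heq, single_one_dotProduct] at h
    exact h
  have hneg := mem_negCone_iff.1 (D.coneLift 𝔣 z).2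
  rw [show D.H.map D.E.subtype *ᵥ ↑(D.coneLift 𝔣 z) = D.Hℂ *ᵥ v from rfl, hHv] at hneg
  simp at hneg

/-! ### The special locus: the `Γ`-saturation of a special sub-ball -/

/-- A finite union of closed sets with empty interior has empty interior. [folklore] -/
private theorem interior_sUnion_eq_empty {α : Type*} [TopologicalSpace α] {F : Set (Set α)}
    (hF : F.Finite) (hc : ∀ B ∈ F, IsClosed B) (hi : ∀ B ∈ F, interior B = ∅) :
    interior (⋃₀ F) = ∅ := by
  induction F, hF using Set.Finite.induction_on with
  | empty => simp
  | @insert a s _ _ ih =>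
    rw [Set.sUnion_insert, interior_union_isClosed_of_interior_empty (hc a (Set.mem_insert _ _))
      (ih (fun B hB ↦ hc B (Set.mem_insert_of_mem _ hB)) (fun B hB ↦ hi B (Set.mem_insert_of_mem _ hB)))]
    exact hi a (Set.mem_insert _ _)

/-- The **special locus** of an `E`-subspace `W ⊆ V` in the ball: the union of the special sub-balls
of all `Γ`-translates of `W`, `⋃_γ 𝔹((γW)^⊥)` — the full preimage in `𝔹²` of the special cycle
`Γ_W\D_W → Γ\𝔹²` of `W`. [cite: BergeronMillsonMoeglin2016Balls, Introduction §1.7] -/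
def specialLocus (W : Submodule D.E (Fin 3 → D.E)) : Set Ball :=
  ⋃ γ : D.Γ, D.specialBall 𝔣 (D.vact γ '' (W : Set (Fin 3 → D.E)))

/-- Membership in the special locus. [cite: BergeronMillsonMoeglin2016Balls, Introduction §1.7] -/
theorem mem_specialLocus_iff {W : Submodule D.E (Fin 3 → D.E)} {z : Ball} :
    z ∈ D.specialLocus 𝔣 W ↔ ∃ γ : D.Γ, z ∈ D.specialBall 𝔣 (D.vact γ '' (W : Set (Fin 3 → D.E))) :=
  Set.mem_iUnion

/-- The special sub-ball of `W` lies in the special locus (`γ = 1`).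
[cite: BergeronMillsonMoeglin2016Balls, Introduction §1.7] -/
theorem specialBall_subset_specialLocus (W : Submodule D.E (Fin 3 → D.E)) :
    D.specialBall 𝔣 (W : Set (Fin 3 → D.E)) ⊆ D.specialLocus 𝔣 W := by
  intro z hz
  refine (D.mem_specialLocus_iff 𝔣).2 ⟨1, ?_⟩
  have : D.vact 1 '' (W : Set (Fin 3 → D.E)) = W := by
    ext w; simp
  rwa [this]

/-- `γ' · (γ · S) = (γ'γ) · S` for sets. [cite: BergeronMillsonMoeglin2016Balls, Part 2 §1.2] -/
theorem vact_image_vact_image (γ γ' : D.Γ) (S : Set (Fin 3 → D.E)) :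
    D.vact γ' '' (D.vact γ '' S) = D.vact (γ' * γ) '' S := by
  rw [Set.image_image]
  exact Set.image_congr' fun w ↦ (D.vact_mul γ' γ w).symm

/-- **The special locus is `Γ`-invariant.** [cite: BergeronMillsonMoeglin2016Balls, Introduction §1.7] -/
theorem smul_mem_specialLocus_iff (W : Submodule D.E (Fin 3 → D.E)) (γ : D.Γ) (z : Ball) :
    D.ballRep 𝔣 γ • z ∈ D.specialLocus 𝔣 W ↔ z ∈ D.specialLocus 𝔣 W := by
  simp only [mem_specialLocus_iff]
  constructor
  · rintro ⟨γ', h⟩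
    refine ⟨γ⁻¹ * γ', ?_⟩
    rw [← D.smul_mem_specialBall_iff 𝔣 γ, vact_image_vact_image, mul_inv_cancel_left]
    exact h
  · rintro ⟨γ', h⟩
    refine ⟨γ * γ', ?_⟩
    rw [← vact_image_vact_image, D.smul_mem_specialBall_iff 𝔣 γ]
    exact h

/-- **Local finiteness**: every ball point has an open neighbourhood meeting only finitely many of the
special sub-balls `𝔹((γW)^⊥)`. [cite: KudlaMillson1990, Lemma 1.1, p. 128] -/
theorem exists_isOpen_finite_specialBall_translates (W : Submodule D.E (Fin 3 → D.E)) (z : Ball) :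
    ∃ U : Set Ball, IsOpen U ∧ z ∈ U ∧
      {B : Set Ball | (∃ γ : D.Γ, D.specialBall 𝔣 (D.vact γ '' (W : Set (Fin 3 → D.E))) = B) ∧
        (B ∩ U).Nonempty}.Finite := by
  obtain ⟨K, hK, hKz⟩ := exists_compact_mem_nhds z
  refine ⟨interior K, isOpen_interior, mem_interior_iff_mem_nhds.2 hKz, ?_⟩
  refine (D.finite_specialBall_translates_submodule 𝔣 W hK).subset ?_
  rintro B ⟨hB, hBK⟩
  exact ⟨hB, hBK.mono (Set.inter_subset_inter_right _ interior_subset)⟩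

/-- **Local structure of the special locus**: near any ball point it is a FINITE union of special
sub-balls `𝔹((γW)^⊥)`. [cite: KudlaMillson1990, Lemma 1.1, p. 128] -/
theorem exists_isOpen_specialLocus_inter_eq (W : Submodule D.E (Fin 3 → D.E)) (z : Ball) :
    ∃ (U : Set Ball) (F : Set (Set Ball)), IsOpen U ∧ z ∈ U ∧ F.Finite ∧
      (∀ B ∈ F, ∃ γ : D.Γ, D.specialBall 𝔣 (D.vact γ '' (W : Set (Fin 3 → D.E))) = B) ∧
      D.specialLocus 𝔣 W ∩ U = ⋃₀ F ∩ U := by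
  obtain ⟨U, hU, hzU, hfin⟩ := D.exists_isOpen_finite_specialBall_translates 𝔣 W z
  refine ⟨U, _, hU, hzU, hfin, fun B hB ↦ hB.1, ?_⟩
  ext w
  simp only [Set.mem_inter_iff, mem_specialLocus_iff, Set.mem_sUnion, Set.mem_setOf_eq]
  constructor
  · rintro ⟨⟨γ, hγ⟩, hwU⟩
    exact ⟨⟨_, ⟨⟨γ, rfl⟩, ⟨w, hγ, hwU⟩⟩, hγ⟩, hwU⟩
  · rintro ⟨⟨B, ⟨⟨γ, rfl⟩, -⟩, hwB⟩, hwU⟩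
    exact ⟨⟨γ, hwB⟩, hwU⟩

/-- **The special locus is closed** ("`j₁ : Γ_W\D_W → Γ\D` is a proper embedding": a locally finite
union of closed sub-balls). [cite: KudlaMillson1990, Lemma 1.1, p. 128] -/
theorem isClosed_specialLocus (W : Submodule D.E (Fin 3 → D.E)) : IsClosed (D.specialLocus 𝔣 W) := by
  -- the locus is the union of the locally finite family of its distinct translates
  set ι := {B : Set Ball | ∃ γ : D.Γ, D.specialBall 𝔣 (D.vact γ '' (W : Set (Fin 3 → D.E))) = B}
  have hunion : D.specialLocus 𝔣 W = ⋃ B : ι, (B : Set Ball) := by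
    ext w
    simp only [mem_specialLocus_iff, Set.mem_iUnion]
    constructor
    · rintro ⟨γ, hγ⟩
      exact ⟨⟨_, γ, rfl⟩, hγ⟩
    · rintro ⟨⟨B, γ, rfl⟩, hB⟩
      exact ⟨γ, hB⟩
  have hlf : LocallyFinite fun B : ι ↦ (B : Set Ball) := by
    intro w
    obtain ⟨U, hU, hwU, hfin⟩ := D.exists_isOpen_finite_specialBall_translates 𝔣 W w
    refine ⟨U, hU.mem_nhds hwU, ?_⟩
    refine (hfin.preimage Subtype.val_injective.injOn).subset ?_
    rintro ⟨B, hB⟩ hBU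
    exact ⟨hB, hBU⟩
  rw [hunion]
  refine hlf.isClosed_iUnion ?_
  rintro ⟨B, γ, rfl⟩
  exact D.isClosed_specialBall 𝔣 _

/-- The translate `γ W`, as a submodule (`γ` acts `E`-linearly).
[cite: BergeronMillsonMoeglin2016Balls, Part 2 §1.2] -/
theorem vact_image_coe (γ : D.Γ) (W : Submodule D.E (Fin 3 → D.E)) :
    D.vact γ '' (W : Set (Fin 3 → D.E)) =
      (W.map (Matrix.mulVecLin ((γ : GL (Fin 3) D.E) : Matrix (Fin 3) (Fin 3) D.E)) :
        Set (Fin 3 → D.E)) := by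
  rw [Submodule.map_coe]; rfl

/-- The linear map `γ · ` on `V` is injective. [cite: BergeronMillsonMoeglin2016Balls, Part 2 §1.2] -/
theorem mulVecLin_injective (γ : D.Γ) :
    Function.Injective (Matrix.mulVecLin ((γ : GL (Fin 3) D.E) : Matrix (Fin 3) (Fin 3) D.E)) :=
  mulVec_injective_iff_isUnit.2 (Units.isUnit _)

/-- **The special locus of a non-zero subspace has empty interior** (every translate `γW` contains
a non-zero vector, whose special sub-ball is nowhere dense; locally the locus is a finite union of
these). [cite: BergeronMillsonMoeglin2016Balls, Introduction §1.7] -/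
theorem interior_specialLocus_eq_empty {W : Submodule D.E (Fin 3 → D.E)} (hW : W ≠ ⊥) :
    interior (D.specialLocus 𝔣 W) = ∅ := by
  obtain ⟨s, hsW, hs⟩ := Submodule.exists_mem_ne_zero_of_ne_bot hW
  rw [Set.eq_empty_iff_forall_notMem]
  intro z hz
  obtain ⟨U, F, hU, hzU, hF, hFW, hloc⟩ := D.exists_isOpen_specialLocus_inter_eq 𝔣 W z
  -- `z` is interior to the finite union `⋃₀ F`, each member of which is closed with empty interior
  have hsub : interior (D.specialLocus 𝔣 W) ∩ U ⊆ ⋃₀ F := fun w hw ↦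
    ((Set.ext_iff.1 hloc w).1 ⟨interior_subset hw.1, hw.2⟩).1
  have hint : interior (⋃₀ F) = ∅ := by
    refine interior_sUnion_eq_empty hF ?_ ?_
    · intro B hB
      obtain ⟨γ, rfl⟩ := hFW B hB
      exact D.isClosed_specialBall 𝔣 _
    · intro B hB
      obtain ⟨γ, rfl⟩ := hFW B hB
      -- `𝔹((γW)^⊥) ⊆ 𝔹((γ s)^⊥)`, which has empty interior
      have hsub' : D.specialBall 𝔣 (D.vact γ '' (W : Set (Fin 3 → D.E))) ⊆ D.specialBall 𝔣 {D.vact γ s} :=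
        D.specialBall_mono 𝔣 (Set.singleton_subset_iff.2 ⟨s, hsW, rfl⟩)
      have hne : D.vact γ s ≠ 0 := by
        intro h0
        apply hs
        have := congrArg (D.vact γ⁻¹) h0
        rwa [vact_inv_vact, show D.vact γ⁻¹ (0 : Fin 3 → D.E) = 0 by simp [vact]] at this
      exact Set.eq_empty_of_subset_empty
        ((interior_mono hsub').trans (D.interior_specialBall_singleton 𝔣 hne).le)
  have hzin : z ∈ interior (⋃₀ F) := by
    rw [mem_interior]
    exact ⟨interior (D.specialLocus 𝔣 W) ∩ U, hsub, isOpen_interior.inter hU, hz, hzU⟩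
  rw [hint] at hzin
  exact hzin

/-- **For `dim_E W = 2` every special sub-ball `𝔹((γW)^⊥)` is a point or empty.**
[cite: BergeronMillsonMoeglin2016Balls, Introduction §1.7] -/
theorem subsingleton_specialBall_translate_of_finrank_eq_two {W : Submodule D.E (Fin 3 → D.E)}
    (h2 : Module.finrank D.E W = 2) (γ : D.Γ) :
    (D.specialBall 𝔣 (D.vact γ '' (W : Set (Fin 3 → D.E)))).Subsingleton := by
  -- a basis `s, s'` of `W`; its translate is an independent pair spanning `γW`
  let b := Module.finBasisOfFinrankEq D.E W h2
  set s : Fin 3 → D.E := (b 0).1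
  set s' : Fin 3 → D.E := (b 1).1
  have hli : LinearIndependent D.E ![s, s'] := by
    have h1 : LinearIndependent D.E (fun i ↦ ((b i : W) : Fin 3 → D.E)) :=
      b.linearIndependent.map' W.subtype W.ker_subtype
    convert h1 using 1
    funext i; fin_cases i <;> rfl
  have hli' : LinearIndependent D.E ![D.vact γ s, D.vact γ s'] := by
    rw [LinearIndependent.pair_iff] at hli ⊢
    intro a c hac
    refine hli a c (D.mulVecLin_injective γ ?_)
    rw [map_add, map_smul, map_smul, map_zero]
    exact hac
  -- `𝔹((γW)^⊥) ⊆ 𝔹({γ s, γ s'}^⊥)`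
  have hsub : D.specialBall 𝔣 (D.vact γ '' (W : Set (Fin 3 → D.E))) ⊆
      D.specialBall 𝔣 {D.vact γ s, D.vact γ s'} := by
    refine D.specialBall_mono 𝔣 ?_
    rintro _ (rfl | rfl)
    · exact ⟨s, (b 0).2, rfl⟩
    · exact ⟨s', (b 1).2, rfl⟩
  exact (D.subsingleton_specialBall_pair 𝔣 hli').anti hsub

/-- **For `dim_E W = 2` the special locus is discrete**: it meets every compact set in finitely many
points (locally finitely many translates, each a point or empty).
[cite: BergeronMillsonMoeglin2016Balls, Introduction §1.7] -/
theorem finite_specialLocus_inter_of_finrank_eq_two {W : Submodule D.E (Fin 3 → D.E)}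
    (h2 : Module.finrank D.E W = 2) {K : Set Ball} (hK : IsCompact K) :
    (D.specialLocus 𝔣 W ∩ K).Finite := by
  have hfin := D.finite_specialBall_translates_submodule 𝔣 W hK
  have hsub : D.specialLocus 𝔣 W ∩ K ⊆
      ⋃ B ∈ {B : Set Ball | (∃ γ : D.Γ, D.specialBall 𝔣 (D.vact γ '' (W : Set (Fin 3 → D.E))) = B) ∧
        (B ∩ K).Nonempty}, B ∩ K := by
    rintro w ⟨hw, hwK⟩
    obtain ⟨γ, hγ⟩ := (D.mem_specialLocus_iff 𝔣).1 hw
    exact Set.mem_biUnion ⟨⟨γ, rfl⟩, ⟨w, hγ, hwK⟩⟩ ⟨hγ, hwK⟩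
  refine (hfin.biUnion fun B hB ↦ ?_).subset hsub
  obtain ⟨γ, rfl⟩ := hB.1
  exact ((D.subsingleton_specialBall_translate_of_finrank_eq_two 𝔣 h2 γ).anti
    Set.inter_subset_left).finite

/-- **The special locus of `W = V` is empty.** [cite: BergeronMillsonMoeglin2016Balls, Part 2 §3.3] -/
theorem specialLocus_top : D.specialLocus 𝔣 ⊤ = ∅ := by
  rw [Set.eq_empty_iff_forall_notMem]
  intro z hz
  obtain ⟨γ, hγ⟩ := (D.mem_specialLocus_iff 𝔣).1 hz
  have himg : D.vact γ '' ((⊤ : Submodule D.E (Fin 3 → D.E)) : Set (Fin 3 → D.E)) = Set.univ := by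
    rw [Submodule.top_coe, Set.image_univ, Set.range_eq_univ]
    intro w
    exact ⟨D.vact γ⁻¹ w, D.vact_vact_inv γ w⟩
  rw [himg, specialBall_univ] at hγ
  exact hγ

/-! ### The special cycle in `X(ℂ)` -/

namespace SpecialCycle

/-- The uniformisation of the affine ball is an open map (`unif` is open on the cone and the ball
chart `coneChart` is a continuous surjection). [cite: BergeronMillsonMoeglin2016Balls, Introduction §1.1] -/
theorem isOpenMap_ballUnifMap : IsOpenMap (D.ballUnifMap 𝔣) := by
  intro U hU
  have heq : D.ballUnifMap 𝔣 '' U = D.cone.restrict D.unif '' (D.coneChart 𝔣 ⁻¹' U) := by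
    ext P
    constructor
    · rintro ⟨z, hz, rfl⟩
      refine ⟨D.coneLift 𝔣 z, ?_, rfl⟩
      rw [Set.mem_preimage, coneChart_coneLift]
      exact hz
    · rintro ⟨v, hv, rfl⟩
      exact ⟨D.coneChart 𝔣 v, hv, (D.unif_eq_ballUnifMap_coneChart 𝔣 v).symm⟩
  rw [heq]
  exact D.isOpenMap_unif _ (hU.preimage (D.continuous_coneChart 𝔣))

end SpecialCycle

export SpecialCycle (isOpenMap_ballUnifMap)

/-- **The preimage of the special cycle is the special locus**: a ball point maps into the image of
`𝔹(W^⊥)` iff it lies on some translate `𝔹((γW)^⊥)` (the fibres of the uniformisation are the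
`Γ`-orbits). [cite: BergeronMillsonMoeglin2016Balls, Introduction §1.7] -/
theorem ballUnifMap_mem_image_specialBall_iff (W : Submodule D.E (Fin 3 → D.E)) (z : Ball) :
    D.ballUnifMap 𝔣 z ∈ D.ballUnifMap 𝔣 '' D.specialBall 𝔣 (W : Set (Fin 3 → D.E)) ↔
      z ∈ D.specialLocus 𝔣 W := by
  constructor
  · rintro ⟨z', hz', heq⟩
    obtain ⟨γ, hγ⟩ := (D.ballUnifMap_eq_iff 𝔣 z' z).1 heq
    rw [← hγ, smul_mem_specialLocus_iff]
    exact D.specialBall_subset_specialLocus 𝔣 W hz'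
  · intro hz
    obtain ⟨γ, hγ⟩ := (D.mem_specialLocus_iff 𝔣).1 hz
    refine ⟨(D.ballRep 𝔣 γ)⁻¹ • z, ?_, ?_⟩
    · rw [← D.smul_mem_specialBall_iff 𝔣 γ, smul_inv_smul]
      exact hγ
    · rw [← map_inv, ballUnifMap_smul]

/-- The preimage of the special cycle under the uniformisation is the special locus.
[cite: BergeronMillsonMoeglin2016Balls, Introduction §1.7] -/
theorem preimage_ballUnifMap_image_specialBall (W : Submodule D.E (Fin 3 → D.E)) :
    D.ballUnifMap 𝔣 ⁻¹' (D.ballUnifMap 𝔣 '' D.specialBall 𝔣 (W : Set (Fin 3 → D.E))) =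
      D.specialLocus 𝔣 W :=
  Set.ext fun z ↦ D.ballUnifMap_mem_image_specialBall_iff 𝔣 W z

/-- The special cycle is also the image of the whole special locus.
[cite: BergeronMillsonMoeglin2016Balls, Introduction §1.7] -/
theorem image_specialLocus (W : Submodule D.E (Fin 3 → D.E)) :
    D.ballUnifMap 𝔣 '' D.specialLocus 𝔣 W =
      D.ballUnifMap 𝔣 '' D.specialBall 𝔣 (W : Set (Fin 3 → D.E)) := by
  refine Set.Subset.antisymm ?_ (Set.image_mono (D.specialBall_subset_specialLocus 𝔣 W))
  rintro _ ⟨z, hz, rfl⟩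
  exact (D.ballUnifMap_mem_image_specialBall_iff 𝔣 W z).2 hz

/-- **The special cycle is closed in `X(ℂ)`**: its complement is the image of the complement of the
(closed, `Γ`-invariant) special locus under the open surjection `ballUnifMap`.
[cite: KudlaMillson1990, Lemma 1.1, p. 128] [cite: BergeronMillsonMoeglin2016Balls, Introduction §1.7] -/
theorem isClosed_image_specialBall (W : Submodule D.E (Fin 3 → D.E)) :
    IsClosed (D.ballUnifMap 𝔣 '' D.specialBall 𝔣 (W : Set (Fin 3 → D.E))) := by
  have hcompl : (D.ballUnifMap 𝔣 '' D.specialBall 𝔣 (W : Set (Fin 3 → D.E)))ᶜ =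
      D.ballUnifMap 𝔣 '' (D.specialLocus 𝔣 W)ᶜ := by
    ext P
    constructor
    · intro hP
      obtain ⟨z, rfl⟩ := D.ballUnifMap_surjective 𝔣 P
      exact ⟨z, fun hz ↦ hP ((D.ballUnifMap_mem_image_specialBall_iff 𝔣 W z).2 hz), rfl⟩
    · rintro ⟨z, hz, rfl⟩ hP
      exact hz ((D.ballUnifMap_mem_image_specialBall_iff 𝔣 W z).1 hP)
  rw [← isOpen_compl_iff, hcompl]
  exact isOpenMap_ballUnifMap D 𝔣 _ (D.isClosed_specialLocus 𝔣 W).isOpen_compl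

/-- **Bridge to the datum's special-cycle clause**: the set `unif '' subCone(τ₁ S)` of the datum
(images of the negative vectors orthogonal to `τ₁(S)`) is the image of the special sub-ball `𝔹(S^⊥)`
under the uniformisation of the affine ball. [cite: BergeronMillsonMoeglin2016Balls, Part 2 §3.3] -/
theorem image_unif_subCone_eq (S : Set (Fin 3 → D.E)) :
    D.unif '' subCone D.Hℂ ((fun w ↦ D.τ₁ ∘ w) '' S) = D.ballUnifMap 𝔣 '' D.specialBall 𝔣 S := by
  ext P
  constructor
  · rintro ⟨v, ⟨hv, horth⟩, rfl⟩
    refine ⟨D.coneChart 𝔣 ⟨v, hv⟩, ?_, (D.unif_eq_ballUnifMap_coneChart 𝔣 ⟨v, hv⟩).symm⟩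
    -- the lift of `coneChart v` is a multiple of `v`
    have hch : D.coneChart 𝔣 (D.coneLift 𝔣 (D.coneChart 𝔣 ⟨v, hv⟩)) = D.coneChart 𝔣 ⟨v, hv⟩ :=
      D.coneChart_coneLift 𝔣 _
    obtain ⟨c, hc, hcv⟩ := (D.coneChart_eq_iff 𝔣 _ _).1 hch
    intro s hs
    rw [hcv, pairE_smul_right]
    exact mul_eq_zero_of_right _ (horth _ ⟨s, hs, rfl⟩)
  · rintro ⟨z, hz, rfl⟩
    refine ⟨(D.coneLift 𝔣 z : Fin 3 → ℂ), ⟨(D.coneLift 𝔣 z).2, ?_⟩, rfl⟩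
    rintro _ ⟨s, hs, rfl⟩
    exact hz s hs

end UnitaryBallUniformisationDatum

end Literature.AlgebraicGeometry.ShimuraVarieties

end
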